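import Summits.Schanuel.Schanuel.Theorems.ZilberEacExpExpRoot
import Summits.Schanuel.Schanuel.Theorems.ZilberEacComplexPunctureDecouplingLemmas
import HarnessLib

/-!
# The exp–exp balance in several variables, II: the contraction step near a line

Zilber's Exponential-Algebraic Closedness, case ladder (host summit Schanuel, cell `pub-schanuel`,
seat 2, gen 10).  The `(s+2)`-fold `W = polyFibredGraph g A F` over the graph hypersurface
`x_{s+1} = g(x₀, …, x_s)` with moving targets `yⱼ = Aⱼ(x) + y_{s+1} Fⱼ(y_{s+1})`, `Fⱼ ∈ ℂ[u] ∖ 0`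
univariate, has exponential points = solutions of

  `e^{xⱼ} = Aⱼ(x) + e^{g(x)} Fⱼ(e^{g(x)})`,  `j = 0, …, s`.

In the EXPLOSION regime ALL fibres balance: `e^{xⱼ} ≈ cⱼ e^{eⱼ g(x)}` (`eⱼ = 1 + deg Fⱼ`,
`cⱼ = lc Fⱼ = e^{Λⱼ}`), i.e. `ζⱼ := xⱼ - eⱼ g(x) + Vⱼ ≈ 0` with `Vⱼ = 2πikⱼ - Λⱼ`.  Since
`e_{j} = λⱼ e₀` these force `x_{j} - λⱼ x₀ = νⱼ + ηⱼ` with `νⱼ = λⱼV₀ - V_{j}` and `ηⱼ` tiny: the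
solutions live super-exponentially close to the LINE `ℓ_ν : z ↦ (z, λ z + ν)` of the base, near a
root `z₀` of the one-variable balance `e₀ p_ν(z) - z = V₀`, `p_ν = g ∘ ℓ_ν`.

`exists_solution_nearLine_step` is the contraction step with every analytic estimate as a
hypothesis (discharged asymptotically in `ZilberEacExplosionExistence`): in the coordinates
`ξ ∈` unit polydisc of `ℂ^{s+1}`, `x(ξ) = ℓ_ν(z₀ + l ξ₀) + (0, δ ξ')` (`l = 1/(1 - e₀p_ν'(z₀))`,
`δ` the `η`-scale), the system becomes `e^{ξ₀} = e^{h}(1 + g₀)`,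
`e^{ξ_{j}} = exp((log(1+g_{j}) - λⱼ log(1+g₀))/δ)` — the shape of the D'Aquino–Fornasiero–Terzo
contraction lemma `ExpDominant.exists_exp_eq_one_add` — and a fixed point is translated back
(`exp_eq_of_exp_zeta`, seat 1's `eq_of_exp_eq_exp_of_norm_sub_lt`).

HONEST FRAMING: auxiliary existence step for explicit members of the OPEN cell `EC(3,2)`; NOT
Schanuel's conjecture; EAC ⇏ SC.
-/

noncomputable section

open Complex MvPolynomial Filter Topology Metric
open Literature.NumberTheory.Transcendental Literature.ModelTheory.Zilber

set_option linter.dupNamespace false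

namespace Summit.Schanuel.Schanuel.Theorems

section Step

variable {s : ℕ}

/-- **Back-translation.**  If `lc(F) u^{e} = e^{x - ζ}` (`e = 1 + deg F`) and
`e^{ζ} = 1 + (a + u F̃(u)) e^{ζ - x}` (`F̃ = eraseLead F`), then `e^{x} = a + u F(u)`. [folklore] -/
theorem exp_eq_of_exp_zeta (F : Polynomial ℂ) {a u x ζ : ℂ}
    (hcue : F.leadingCoeff * u ^ (F.natDegree + 1) = exp (x - ζ))
    (hζ : exp ζ = 1 + (a + u * F.eraseLead.eval u) * exp (ζ - x)) :
    exp x = a + u * F.eval u := by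
  have h2 : exp x = exp (x - ζ) * exp ζ := by rw [← Complex.exp_add]; congr 1; ring
  rw [mul_eval_eq_leadingCoeff_mul_pow_add F u, hcue, h2, hζ, mul_add, mul_one, ← mul_assoc,
    mul_comm (exp (x - ζ)) (a + _), mul_assoc, ← Complex.exp_add,
    show x - ζ + (ζ - x) = 0 by ring, Complex.exp_zero, mul_one]
  ring

/-- `‖e^{h}(1 + g) - 1‖ ≤ 2‖h‖(1 + ‖g‖) + ‖g‖` for `‖h‖ ≤ 1`. [folklore] -/
theorem norm_exp_mul_one_add_sub_one_le' {h g : ℂ} (hh : ‖h‖ ≤ 1) :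
    ‖exp h * (1 + g) - 1‖ ≤ 2 * ‖h‖ * (1 + ‖g‖) + ‖g‖ := by
  have h1 : ‖exp h - 1‖ ≤ 2 * ‖h‖ := Complex.norm_exp_sub_one_le hh
  have hsplit : exp h * (1 + g) - 1 = (exp h - 1) * (1 + g) + g := by ring
  rw [hsplit]
  calc ‖(exp h - 1) * (1 + g) + g‖ ≤ ‖exp h - 1‖ * ‖1 + g‖ + ‖g‖ := by
        refine (norm_add_le _ _).trans ?_; rw [norm_mul]
    _ ≤ (2 * ‖h‖) * (1 + ‖g‖) + ‖g‖ := by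
        gcongr
        exact (norm_add_le _ _).trans (by rw [norm_one])

/-- **THE CONTRACTION STEP NEAR A LINE** (see the module docstring).  Data: fibre polynomials
`fⱼ ≠ 0` with `e^{Λⱼ} = lc fⱼ`, integers `kⱼ`, `Vⱼ = 2πikⱼ - Λⱼ`, slopes `λⱼ e₀ = e_{j+1}`, offsets
`νⱼ = λⱼ V₀ - V_{j+1}`, a polynomial `p` (in the application: the restriction of `g` to the line;
here only the two error bounds tie `p` to `g`), a root `z₀` of `e₀ p(z) - z = V₀`,
`l (1 - e₀ p'(z₀)) = 1`, `‖l‖ ≤ L`, the `η`-scale `0 < δ ≤ 1`, `16(s+2)ε ≤ 1`, and a perturbation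
level `θ ≤ ε/16` with `4θ(1 + ‖λ‖) ≤ εδ`; hypotheses: linearisation error `≤ ε/16`, off-line error
`≤ ε/16`, perturbations `≤ θ` on the region.  Conclusion: a solution `x` of the whole system with
`‖x₀ - z₀‖ ≤ L`, `‖x_{j+1} - λⱼx₀ - νⱼ‖ ≤ δ` and `e₀ g(x) = x₀ + V₀ - ζ₀`, `‖ζ₀‖ ≤ 1`. (new)
[cite: MantovaMasser2023, §1 p.5 (the open case dim π(V) = 2 in ℂ³×ℂˣ³)] -/
theorem exists_solution_nearLine_step (g : MvPolynomial (Fin (s + 1)) ℂ)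
    (A : Fin (s + 1) → MvPolynomial (Fin (s + 1)) ℂ) (f : Fin (s + 1) → Polynomial ℂ)
    {Λ V : Fin (s + 1) → ℂ} {k : Fin (s + 1) → ℤ}
    (hΛ : ∀ j, exp (Λ j) = (f j).leadingCoeff) (hV : ∀ j, Λ j + V j = 2 * Real.pi * I * k j)
    {lam ν : Fin s → ℂ}
    (hlam : ∀ j, lam j * (((f 0).natDegree + 1 : ℕ) : ℂ) = (((f j.succ).natDegree + 1 : ℕ) : ℂ))
    (hν : ∀ j, ν j = lam j * V 0 - V j.succ)
    {p : Polynomial ℂ} {z₀ l : ℂ} {L δ ε θ : ℝ}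
    (hroot : (((f 0).natDegree + 1 : ℕ) : ℂ) * p.eval z₀ - z₀ - V 0 = 0)
    (hl : l * (1 - (((f 0).natDegree + 1 : ℕ) : ℂ) * p.derivative.eval z₀) = 1) (hl1 : ‖l‖ ≤ L)
    (hδ : 0 < δ) (hδ1 : δ ≤ 1) (hε0 : 0 < ε) (hε : 16 * ((s : ℝ) + 2) * ε ≤ 1)
    (hθ1 : θ ≤ ε / 16) (hθ2 : 4 * θ * (1 + ‖lam‖) ≤ ε * δ)
    (hlin : ∀ t : ℂ, ‖t‖ ≤ 1 → ‖(((f 0).natDegree + 1 : ℕ) : ℂ) *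
      (p.eval (z₀ + l * t) - p.eval z₀ - p.derivative.eval z₀ * (l * t))‖ ≤ ε / 16)
    (hoff : ∀ ξ : Fin (s + 1) → ℂ, ‖ξ‖ ≤ 1 → ‖(((f 0).natDegree + 1 : ℕ) : ℂ) *
      (eval (Fin.cons (z₀ + l * ξ 0) (fun j => lam j * (z₀ + l * ξ 0) + ν j + δ * ξ j.succ) :
          Fin (s + 1) → ℂ) g - p.eval (z₀ + l * ξ 0))‖ ≤ ε / 16)
    (hpert : ∀ j, ∀ x : Fin (s + 1) → ℂ, ‖x 0 - z₀‖ ≤ L →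
      (∀ i : Fin s, ‖x i.succ - lam i * x 0 - ν i‖ ≤ δ) → ∀ ζ u : ℂ, ‖ζ‖ ≤ 2 * (1 + ‖lam‖) →
      (f j).leadingCoeff * u ^ ((f j).natDegree + 1) = exp (x j - ζ) →
      ‖(eval x (A j) + u * (f j).eraseLead.eval u) * exp (ζ - x j)‖ ≤ θ) :
    ∃ x : Fin (s + 1) → ℂ,
      (∀ j, exp (x j) = eval x (A j) + exp (eval x g) * (f j).eval (exp (eval x g))) ∧
      ‖x 0 - z₀‖ ≤ L ∧ (∀ i : Fin s, ‖x i.succ - lam i * x 0 - ν i‖ ≤ δ) ∧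
      ∃ ζ₀ : ℂ, ‖ζ₀‖ ≤ 1 ∧ (((f 0).natDegree + 1 : ℕ) : ℂ) * eval x g = x 0 + V 0 - ζ₀ := by
  classical
  -- ### numerology
  have hs0 : (0 : ℝ) ≤ s := Nat.cast_nonneg s
  have hε1 : ε ≤ 1 / 32 := by nlinarith
  have hL0 : 0 ≤ L := (norm_nonneg l).trans hl1
  have hlam0 : 0 ≤ ‖lam‖ := norm_nonneg _
  have hθε : θ * (1 + ‖lam‖) ≤ ε * δ / 4 := by nlinarith
  set e : Fin (s + 1) → ℕ := fun j => (f j).natDegree + 1 with he_def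
  -- ### the functions of the local coordinate `ξ`
  set zf : (Fin (s + 1) → ℂ) → ℂ := fun ξ => z₀ + l * ξ 0 with hzf
  set xf : (Fin (s + 1) → ℂ) → Fin (s + 1) → ℂ := fun ξ =>
    Fin.cons (zf ξ) (fun j => lam j * zf ξ + ν j + δ * ξ j.succ) with hxf
  set gx : (Fin (s + 1) → ℂ) → ℂ := fun ξ => eval (xf ξ) g with hgx
  set uf : (Fin (s + 1) → ℂ) → ℂ := fun ξ => exp (gx ξ) with huf
  set ζf : Fin (s + 1) → (Fin (s + 1) → ℂ) → ℂ := fun j ξ =>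
    xf ξ j - (e j : ℂ) * gx ξ + V j with hζf
  set pert : Fin (s + 1) → (Fin (s + 1) → ℂ) → ℂ := fun j ξ =>
    (eval (xf ξ) (A j) + uf ξ * (f j).eraseLead.eval (uf ξ)) * exp (ζf j ξ - xf ξ j) with hpert_def
  set hf : (Fin (s + 1) → ℂ) → ℂ := fun ξ =>
    (e 0 : ℂ) * (p.eval (zf ξ) - p.eval z₀ - p.derivative.eval z₀ * (l * ξ 0)) +
      (e 0 : ℂ) * (gx ξ - p.eval (zf ξ)) with hhf
  set wf : Fin s → (Fin (s + 1) → ℂ) → ℂ := fun j ξ =>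
    log (1 + pert j.succ ξ) - lam j * log (1 + pert 0 ξ) with hwf
  set G : Fin (s + 1) → (Fin (s + 1) → ℂ) → ℂ :=
    Fin.cons (fun ξ => exp (hf ξ) * (1 + pert 0 ξ) - 1) (fun j ξ => exp (wf j ξ / δ) - 1) with hG
  -- ### identities
  have hxf0 : ∀ ξ, xf ξ 0 = zf ξ := fun ξ => by simp only [hxf, Fin.cons_zero]
  have hxfs : ∀ ξ (j : Fin s), xf ξ j.succ = lam j * zf ξ + ν j + δ * ξ j.succ := fun ξ j => by
    simp only [hxf, Fin.cons_succ]
  have hζ0 : ∀ ξ, ζf 0 ξ = ξ 0 - hf ξ := by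
    intro ξ
    simp only [hζf, hhf, hxf0, hzf]
    linear_combination (-1 : ℂ) * hroot + ξ 0 * hl
  have hζs : ∀ ξ (j : Fin s), ζf j.succ ξ = lam j * ζf 0 ξ + δ * ξ j.succ := by
    intro ξ j
    simp only [hζf, hxfs, hxf0]
    linear_combination hν j + gx ξ * hlam j
  have hcue : ∀ j ξ, (f j).leadingCoeff * uf ξ ^ ((f j).natDegree + 1) = exp (xf ξ j - ζf j ξ) := by
    intro j ξ
    rw [← hΛ j, huf, ← Complex.exp_nat_mul, ← Complex.exp_add]
    have : Λ j + (((f j).natDegree + 1 : ℕ) : ℂ) * gx ξ = xf ξ j - ζf j ξ + k j * (2 * Real.pi * I) := by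
      simp only [hζf, he_def]
      linear_combination hV j
    rw [this, Complex.exp_add, Complex.exp_int_mul_two_pi_mul_I, mul_one]
  -- ### bounds on the closed unit polydisc
  have hbd : ∀ ξ : Fin (s + 1) → ℂ, ‖ξ‖ ≤ 1 →
      ‖hf ξ‖ ≤ ε / 8 ∧ ‖ζf 0 ξ‖ ≤ 3 / 2 ∧ ‖xf ξ 0 - z₀‖ ≤ L ∧
        (∀ i : Fin s, ‖xf ξ i.succ - lam i * xf ξ 0 - ν i‖ ≤ δ) ∧ (∀ j, ‖pert j ξ‖ ≤ θ) := by
    intro ξ hξ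
    have hξi : ∀ i, ‖ξ i‖ ≤ 1 := fun i => (norm_le_pi_norm ξ i).trans hξ
    have hh : ‖hf ξ‖ ≤ ε / 8 := by
      have h1 := hlin (ξ 0) (hξi 0)
      have h2 := hoff ξ hξ
      calc ‖hf ξ‖ ≤ ‖(e 0 : ℂ) * (p.eval (zf ξ) - p.eval z₀ - p.derivative.eval z₀ * (l * ξ 0))‖ +
            ‖(e 0 : ℂ) * (gx ξ - p.eval (zf ξ))‖ := norm_add_le _ _
        _ ≤ ε / 16 + ε / 16 := add_le_add h1 h2
        _ = ε / 8 := by ring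
    have hζ0b : ‖ζf 0 ξ‖ ≤ 3 / 2 := by
      rw [hζ0 ξ]
      exact (norm_sub_le _ _).trans (by linarith [hξi 0])
    have hreg1 : ‖xf ξ 0 - z₀‖ ≤ L := by
      rw [hxf0]
      simp only [hzf, add_sub_cancel_left, norm_mul]
      nlinarith [hξi 0, norm_nonneg l, norm_nonneg (ξ 0)]
    have hreg2 : ∀ i : Fin s, ‖xf ξ i.succ - lam i * xf ξ 0 - ν i‖ ≤ δ := by
      intro i
      rw [hxfs, hxf0, show lam i * zf ξ + ν i + δ * ξ i.succ - lam i * zf ξ - ν i = δ * ξ i.succ by ring,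
        norm_mul, Complex.norm_real, Real.norm_eq_abs, abs_of_pos hδ]
      nlinarith [hξi i.succ]
    have hp0 : ‖pert 0 ξ‖ ≤ θ :=
      hpert 0 (xf ξ) hreg1 hreg2 (ζf 0 ξ) (uf ξ) (hζ0b.trans (by nlinarith)) (hcue 0 ξ)
    have hps : ∀ j : Fin s, ‖pert j.succ ξ‖ ≤ θ := by
      intro j
      have hζb : ‖ζf j.succ ξ‖ ≤ 2 * (1 + ‖lam‖) := by
        rw [hζs]
        calc ‖lam j * ζf 0 ξ + δ * ξ j.succ‖ ≤ ‖lam j‖ * ‖ζf 0 ξ‖ + δ * ‖ξ j.succ‖ := by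
              refine (norm_add_le _ _).trans ?_
              rw [norm_mul, norm_mul, Complex.norm_real, Real.norm_eq_abs, abs_of_pos hδ]
          _ ≤ ‖lam‖ * (3 / 2) + 1 * 1 := by
              gcongr
              · exact norm_le_pi_norm lam j
              · exact hξi j.succ
          _ ≤ 2 * (1 + ‖lam‖) := by nlinarith
      exact hpert j.succ (xf ξ) hreg1 hreg2 _ _ hζb (hcue j.succ ξ)
    exact ⟨hh, hζ0b, hreg1, hreg2, fun j => Fin.cases hp0 hps j⟩
  -- ### smallness of `G` on the unit polydisc
  have hθhalf : θ ≤ 1 / 2 := by linarith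
  have hwb : ∀ ξ : Fin (s + 1) → ℂ, ‖ξ‖ ≤ 1 → ∀ j : Fin s, ‖wf j ξ‖ ≤ 3 / 8 * ε * δ := by
    intro ξ hξ j
    obtain ⟨-, -, -, -, hpb⟩ := hbd ξ hξ
    have h1 : ‖log (1 + pert j.succ ξ)‖ ≤ 3 / 2 * ‖pert j.succ ξ‖ :=
      Complex.norm_log_one_add_half_le_self ((hpb j.succ).trans hθhalf)
    have h0 : ‖log (1 + pert 0 ξ)‖ ≤ 3 / 2 * ‖pert 0 ξ‖ :=
      Complex.norm_log_one_add_half_le_self ((hpb 0).trans hθhalf)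
    calc ‖wf j ξ‖ ≤ ‖log (1 + pert j.succ ξ)‖ + ‖lam j‖ * ‖log (1 + pert 0 ξ)‖ := by
          refine (norm_sub_le _ _).trans ?_; rw [norm_mul]
      _ ≤ 3 / 2 * θ + ‖lam‖ * (3 / 2 * θ) := by
          have hl' := norm_le_pi_norm lam j
          have hpj := hpb j.succ
          have hp0 := hpb 0
          nlinarith [norm_nonneg (lam j), norm_nonneg (log (1 + pert 0 ξ)), norm_nonneg (pert 0 ξ)]
      _ = 3 / 2 * (θ * (1 + ‖lam‖)) := by ring
      _ ≤ 3 / 8 * ε * δ := by nlinarith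
  have hGsmall : ∀ j, ∀ ξ ∈ ball (0 : Fin (s + 1) → ℂ) 1, ‖G j ξ‖ ≤ ε := by
    intro j ξ hξ
    rw [mem_ball, dist_zero_right] at hξ
    obtain ⟨hh, -, -, -, hpb⟩ := hbd ξ hξ.le
    refine Fin.cases ?_ (fun i => ?_) j
    · simp only [hG, Fin.cons_zero]
      have h1 := norm_exp_mul_one_add_sub_one_le' (g := pert 0 ξ) (hh.trans (by linarith))
      have hp0 := hpb 0
      nlinarith [norm_nonneg (hf ξ), norm_nonneg (pert 0 ξ)]
    · simp only [hG, Fin.cons_succ]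
      have hw := hwb ξ hξ.le i
      have hwδ : ‖wf i ξ / δ‖ ≤ 3 / 8 * ε := by
        rw [norm_div, Complex.norm_real, Real.norm_eq_abs, abs_of_pos hδ, div_le_iff₀ hδ]
        linarith
      have h1 : ‖exp (wf i ξ / δ) - 1‖ ≤ 2 * ‖wf i ξ / δ‖ :=
        Complex.norm_exp_sub_one_le (hwδ.trans (by linarith))
      linarith
  -- ### holomorphy
  have hzf_d : Differentiable ℂ zf :=
    (differentiable_const _).add ((differentiable_const _).mul (differentiable_apply 0))
  have hxf_d : Differentiable ℂ xf := by
    refine differentiable_pi.2 fun i => ?_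
    refine Fin.cases ?_ (fun j => ?_) i
    · simp only [hxf, Fin.cons_zero]; exact hzf_d
    · simp only [hxf, Fin.cons_succ]
      exact (((differentiable_const _).mul hzf_d).add (differentiable_const _)).add
        ((differentiable_const _).mul (differentiable_apply _))
  have hxfj_d : ∀ j, Differentiable ℂ fun ξ => xf ξ j := fun j => differentiable_pi.1 hxf_d j
  have hgx_d : Differentiable ℂ gx := (differentiable_mvPolynomial_eval g).comp hxf_d
  have huf_d : Differentiable ℂ uf := hgx_d.cexp
  have hζf_d : ∀ j, Differentiable ℂ (ζf j) := fun j =>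
    ((hxfj_d j).sub ((differentiable_const _).mul hgx_d)).add (differentiable_const _)
  have hpert_d : ∀ j, Differentiable ℂ (pert j) := fun j =>
    (((differentiable_mvPolynomial_eval (A j)).comp hxf_d).add
      (huf_d.mul ((f j).eraseLead.differentiable.comp huf_d))).mul ((hζf_d j).sub (hxfj_d j)).cexp
  have hhf_d : Differentiable ℂ hf :=
    ((differentiable_const _).mul (((p.differentiable.comp hzf_d).sub (differentiable_const _)).sub
      ((differentiable_const _).mul ((differentiable_const _).mul (differentiable_apply 0))))).add
      ((differentiable_const _).mul (hgx_d.sub (p.differentiable.comp hzf_d)))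
  have hlog_d : ∀ j, ∀ ξ ∈ ball (0 : Fin (s + 1) → ℂ) 1,
      DifferentiableAt ℂ (fun ξ => log (1 + pert j ξ)) ξ := by
    intro j ξ hξ
    rw [mem_ball, dist_zero_right] at hξ
    have hsmall : ‖pert j ξ‖ ≤ θ := (hbd ξ hξ.le).2.2.2.2 j
    have hslit : 1 + pert j ξ ∈ slitPlane := by
      rw [Complex.mem_slitPlane_iff]
      left
      have h1 := Complex.abs_re_le_norm (pert j ξ)
      rw [Complex.add_re, Complex.one_re]
      have h2 := (abs_le.1 h1).1
      linarith
    exact ((differentiable_const _).add (hpert_d j)).differentiableAt.clog hslit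
  have hGdiff : ∀ j, DifferentiableOn ℂ (G j) (ball 0 1) := by
    intro j
    refine Fin.cases ?_ (fun i => ?_) j
    · simp only [hG, Fin.cons_zero]
      exact ((hhf_d.cexp.mul ((differentiable_const _).add (hpert_d 0))).sub
        (differentiable_const _)).differentiableOn
    · simp only [hG, Fin.cons_succ]
      intro ξ hξ
      have h1 := hlog_d i.succ ξ hξ
      have h0 := hlog_d 0 ξ hξ
      have hw : DifferentiableAt ℂ (fun ξ => wf i ξ * ((δ : ℂ)⁻¹)) ξ :=
        (h1.sub ((differentiableAt_const _).mul h0)).mul_const _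
      have hw' : DifferentiableAt ℂ (fun ξ => wf i ξ / (δ : ℂ)) ξ := by
        simpa only [div_eq_mul_inv] using hw
      exact (hw'.cexp.sub (differentiableAt_const _)).differentiableWithinAt
  -- ### the fixed point
  have hε' : 16 * (((s + 1 : ℕ) : ℝ) + 1) * ε ≤ 1 := by
    push_cast
    linarith
  obtain ⟨ξ, hξ, hfix⟩ := ExpDominant.exists_exp_eq_one_add G hε0.le hε' hGdiff hGsmall
  have hξ1 : ‖ξ‖ ≤ 1 := hξ.trans (by norm_num)
  have hξi : ∀ i, ‖ξ i‖ ≤ 1 / 2 := fun i => (norm_le_pi_norm ξ i).trans hξ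
  obtain ⟨hh, hζ0b, hreg1, hreg2, hpb⟩ := hbd ξ hξ1
  -- fibre `0`
  have hexpζ0 : exp (ζf 0 ξ) = 1 + pert 0 ξ := by
    have h0 : exp (ξ 0) = 1 + (exp (hf ξ) * (1 + pert 0 ξ) - 1) := by
      have := hfix 0; simpa only [hG, Fin.cons_zero] using this
    rw [hζ0 ξ, Complex.exp_sub, h0, add_sub_cancel, mul_div_cancel_left₀ _ (Complex.exp_ne_zero _)]
  -- `ζ₀ = log (1 + g₀)`
  have hpert0_ne : 1 + pert 0 ξ ≠ 0 := by
    intro h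
    have h1 : ‖pert 0 ξ‖ = 1 := by
      rw [show pert 0 ξ = -1 by linear_combination h, norm_neg, norm_one]
    linarith [hpb 0]
  have hζ0log : ζf 0 ξ = log (1 + pert 0 ξ) := by
    refine eq_of_exp_eq_exp_of_norm_sub_lt (by rw [hexpζ0, Complex.exp_log hpert0_ne]) ?_
    have h1 : ‖log (1 + pert 0 ξ)‖ ≤ 3 / 2 * ‖pert 0 ξ‖ :=
      Complex.norm_log_one_add_half_le_self ((hpb 0).trans hθhalf)
    have h2 : ‖ζf 0 ξ - log (1 + pert 0 ξ)‖ ≤ ‖ζf 0 ξ‖ + ‖log (1 + pert 0 ξ)‖ := norm_sub_le _ _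
    have h3 := hpb 0
    linarith [Real.pi_gt_three]
  -- the slaved fibres
  have hexpζs : ∀ j : Fin s, exp (ζf j.succ ξ) = 1 + pert j.succ ξ := by
    intro j
    have hj : exp (ξ j.succ) = exp (wf j ξ / δ) := by
      have := hfix j.succ
      simp only [hG, Fin.cons_succ] at this
      rw [this]; ring
    have hwδ : ‖wf j ξ / δ‖ ≤ 3 / 8 * ε := by
      rw [norm_div, Complex.norm_real, Real.norm_eq_abs, abs_of_pos hδ, div_le_iff₀ hδ]
      linarith [hwb ξ hξ1 j]
    have heq : ξ j.succ = wf j ξ / δ := by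
      refine eq_of_exp_eq_exp_of_norm_sub_lt hj ?_
      have h2 : ‖ξ j.succ - wf j ξ / δ‖ ≤ ‖ξ j.succ‖ + ‖wf j ξ / δ‖ := norm_sub_le _ _
      linarith [hξi j.succ, Real.pi_gt_three]
    have hδc : (δ : ℂ) ≠ 0 := by exact_mod_cast hδ.ne'
    have hδξ : (δ : ℂ) * ξ j.succ = wf j ξ := by
      rw [heq]; field_simp
    have hpertj_ne : 1 + pert j.succ ξ ≠ 0 := by
      intro h
      have h1 : ‖pert j.succ ξ‖ = 1 := by
        rw [show pert j.succ ξ = -1 by linear_combination h, norm_neg, norm_one]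
      linarith [hpb j.succ]
    have hζj : ζf j.succ ξ = log (1 + pert j.succ ξ) := by
      rw [hζs ξ j, hδξ, hζ0log, hwf]
      ring
    rw [hζj, Complex.exp_log hpertj_ne]
  -- ### conclusion
  have hζ01 : ‖ζf 0 ξ‖ ≤ 1 := by
    rw [hζ0 ξ]
    exact (norm_sub_le _ _).trans (by linarith [hξi 0])
  refine ⟨xf ξ, fun j => ?_, hreg1, hreg2, ζf 0 ξ, hζ01, ?_⟩
  · have hζ : exp (ζf j ξ) = 1 + pert j ξ := Fin.cases hexpζ0 hexpζs j
    have := exp_eq_of_exp_zeta (f j) (hcue j ξ) (by rw [hζ])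
    simpa only [huf, hgx] using this
  · simp only [hζf, hxf0]
    ring

end Step

end Summit.Schanuel.Schanuel.Theorems

end
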